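import Summits.ResolutionOfSingularities.ResolutionOfSingularities.Theorems.EquisingularLiftEquisingularLiftChainOfHorizChain
import Summits.ResolutionOfSingularities.ResolutionOfSingularities.Theorems.EquisingularLiftEquisingularLiftResolveOnePointDimOne
import Summits.ResolutionOfSingularities.ResolutionOfSingularities.Theorems.EquisingularLiftEquisingularLiftHorizResolutionBase
import Summits.ResolutionOfSingularities.ResolutionOfSingularities.Theorems.EquisingularLiftEquisingularLiftNatRegularCase
import HarnessLib

/-!
# [OURS · L1 W4.5(b)] EL♮ line `sections` — HORIZONTAL E1 CHAINS (the upper sandwich for `stub_elnat_three`)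
# crux `Theses.EquisingularLift.EquisingularLiftNat` (stmt-ResolutionOfSingularities-20038), lead res-L1-w45b-lead-2

NOT a statement of any manuscript; OURS structural plumbing (cell res-hironaka, crux chain w45b). This is the EL♮
analogue of lead-1's `StrataSplit.stub_chain_of_horizChain` (p463069, typed door EL): the global conjunct «the special
fibre of the LAST ambient is irreducible» of the item is replaced by the LOCAL step condition «the centre is FLAT over
`Spec O`» (horizontal), which is what the device lemmas of the line prove chart by chart (`deltaFlat` for Δ-curves,
sections `≅ Spec O`, combs). Why no generality is lost (informal, lead's NOTES): an admissible centre with a vertical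
component makes the special fibre reducible for good, since strict transforms of its components persist under all later
regular-centre blow-ups; so every successful EL♮ chain is horizontal anyway.

* `natChain_and_isIrreducible_of_horizChainE1` — for a smooth proper `q : P → Spec O` over a DVR with INTEGRAL
  scheme-theoretic special fibre and an irreducible closed `Y` inside the special fibre: a HORIZONTAL E1 chain (induction
  principle with step hypotheses `IsBlowup τ C`, `V(C)` regular, `V(C) → Spec O` flat, image of `C` off the generic point
  of `Y`, E1) is an E1 chain of the item AND the last special fibre is irreducible. The special-fibre point off the
  centre that `isIntegral_specialFibre_of_isBlowup_regularCentre` (p461776) wants is the point of `Y'` over the generic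
  point of `Y` (`Split.Chain.fibre`), which lies in the special fibre (`closure_subset_preimage_of_chain`) and off the
  centre (off-generic clause) — so, unlike p463069, no «missed point» hypothesis is carried.
* `stub_elnat_three_of_horiz` — THE RESHAPE of the research stub: `stub_elnat_three` (registered text, line
  `sections`) follows from its HORIZONTAL form `∀ p, …, n = 3 → ¬ IsRegular H → ∃ O π, … ∃ P' σ S', HorizChainE1 ∧
  regular reduced closure of S'` (regular `H`: `elnat_of_isRegular`, p498240; otherwise the fixed-ambient glue of
  `stub_elnat_le_two` / `Theorems.equisingularLift_of_equisingularLiftNatA`: `isPullback_projMap`,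
  `stub_projectiveAmbientSmoothProper`, `isIntegral_specialFibre_projectiveSpace` p465105, and the sandwich above).

References: p463069 / p461776 / p465105 module docstrings (Liu 2002 Thm 8.1.19, Stacks 0805/02ND); L/w45b/CRUX-PLAN.md v3
§1.1 («special fibres irreducible — automatic for horizontal = O-flat C by SF»); L/w45b/EL-NATURAL/SkeletonELnat-v1.lean.
-/

set_option linter.dupNamespace false -- mandated namespace `Summit.<Summit>.<Problem>` of this single-conjunct summit
set_option linter.overlappingInstances false -- signatures carry `[IsDomain O] [IsDiscreteValuationRing O]`

noncomputable section

open CategoryTheory CategoryTheory.Limits AlgebraicGeometry TopologicalSpace Topology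
open Literature.AlgebraicGeometry.Resolution
open AlgebraicGeometry.Scheme.IdealSheafData
open Summit.ResolutionOfSingularities.ResolutionOfSingularities.Theses.EquisingularLift.Split
open Summit.ResolutionOfSingularities.ResolutionOfSingularities.Cruxes.EquisingularLift.StrataSplit

namespace Summit.ResolutionOfSingularities.ResolutionOfSingularities.Cruxes.EquisingularLiftNat.Sections

/-- **HORIZONTAL E1 CHAINS ARE E1 CHAINS WITH IRREDUCIBLE SPECIAL FIBRE.** For a DVR `O`, a smooth proper
`q : P → Spec O` with integral scheme-theoretic special fibre, an irreducible closed `Y` inside the special fibre, and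
`(P', σ, S')` reached from `(P, 𝟙, Y)` by blow-ups in regular centres that are FLAT over `Spec O`, lie over non-generic
points of `Y` and satisfy E1: `(P', σ, S')` is reached by an E1 chain of the item (formal) and the special fibre of
`P' → Spec O` is irreducible (induction with motive «locally Noetherian ∧ regular ∧ integral scheme-theoretic special fibre ∧
plain chain», step = p461776 at the point of `Y'` over the generic point of `Y`). [folklore; Liu 2002 Thm 8.1.19] -/
theorem natChain_and_isIrreducible_of_horizChainE1 : ∀ (O : Type) [CommRing O] [IsDomain O] [IsDiscreteValuationRing O] (P P' : AlgebraicGeometry.Scheme.{0}) (q : P ⟶ AlgebraicGeometry.Spec (.of O)) (Y : Set P) (σ : P' ⟶ P) (S' : Set P'), AlgebraicGeometry.Smooth q → AlgebraicGeometry.IsProper q → AlgebraicGeometry.IsIntegral (CategoryTheory.Limits.pullback q (AlgebraicGeometry.Spec.map (CommRingCat.ofHom (IsLocalRing.residue O)))) → IsIrreducible Y → IsClosed Y → Y ⊆ q ⁻¹' {IsLocalRing.closedPoint O} → (∀ Q : (∀ X' : AlgebraicGeometry.Scheme.{0}, (X' ⟶ P) → Set X' → Prop), Q P (CategoryTheory.CategoryStruct.id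 P) Y → (∀ (X' X'' : AlgebraicGeometry.Scheme.{0}) (σ' : X' ⟶ P) (Y' : Set X') (C : X'.IdealSheafData) (τ : X'' ⟶ X'), Q X' σ' Y' → Literature.AlgebraicGeometry.Resolution.IsBlowup τ C → Literature.AlgebraicGeometry.Resolution.Scheme.IsRegular C.subscheme → AlgebraicGeometry.Flat (CategoryTheory.CategoryStruct.comp C.subschemeι (CategoryTheory.CategoryStruct.comp σ' q)) → σ' '' (C.support : Set X') ⊆ {x | ¬ IsGenericPoint x Y} → (C.support : Set X') ∩ (CategoryTheory.CategoryStruct.comp σ' q) ⁻¹' {IsLocalRing.closedPoint O} ⊆ Y' → Q X'' (CategoryTheory.CategoryStruct.comp τ σ') (closure (τ ⁻¹' (Y' \ (C.support : Set X'))))) → Q P' σ S') → (∀ Q : (∀ X' : AlgebraicGeometry.Scheme.{0}, (X' ⟶ P) → Set X' → Prop), Q P (CategoryTheory.CategoryStruct.id P) Y → (∀ (X' X'' : AlgebraicGeometry.Scheme.{0}) (σ' : X' ⟶ P) (Y' : Set X') (C : X'.IdealSheafData) (τ : X'' ⟶ X'), Q X' σ' Y' → Literature.AlgebraicGeometry.Resolution.IsBlowup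 τ C → Literature.AlgebraicGeometry.Resolution.Scheme.IsRegular C.subscheme → σ' '' (C.support : Set X') ⊆ {x | ¬ IsGenericPoint x Y} → (C.support : Set X') ∩ (CategoryTheory.CategoryStruct.comp σ' q) ⁻¹' {IsLocalRing.closedPoint O} ⊆ Y' → Q X'' (CategoryTheory.CategoryStruct.comp τ σ') (closure (τ ⁻¹' (Y' \ (C.support : Set X'))))) → Q P' σ S') ∧ IsIrreducible ((CategoryTheory.CategoryStruct.comp σ q) ⁻¹' {IsLocalRing.closedPoint O}) := by
  intro O _ _ _ P P' q Y σ S' hsm hpr hint hYirr hYcl hY hH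
  refine ⟨?_, ?_⟩
  · -- `HorizChainE1 ⇒ E1-chain`: closure under all E1 regular-centre steps implies closure under the flat ones
    intro Q h0 hstep
    exact hH Q h0 (fun X' X'' σ' Y' C τ hQ hτ hC _ himg hE1 => hstep X' X'' σ' Y' C τ hQ hτ hC himg hE1)
  · -- irreducibility of the final special fibre, by induction with the motive below
    have hN : IsLocallyNoetherian P := by
      haveI := hsm
      exact LocallyOfFiniteType.isLocallyNoetherian q
    have hR : Scheme.IsRegular P := fun y => (stub_goodAtOfSmooth O P q hsm y).1
    have hint₀ : IsIntegral (pullback (𝟙 P ≫ q) (Spec.map (CommRingCat.ofHom (IsLocalRing.residue O)))) := by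
      simpa only [Category.id_comp] using hint
    obtain ⟨ξ, hξ⟩ : ∃ ξ : P, IsGenericPoint ξ Y := QuasiSober.sober hYirr hYcl
    have key := hH (fun X' σ' Y' => IsLocallyNoetherian X' ∧ Scheme.IsRegular X' ∧
        IsIntegral (pullback (σ' ≫ q) (Spec.map (CommRingCat.ofHom (IsLocalRing.residue O)))) ∧ Chain P Y X' σ' Y')
      ⟨hN, hR, hint₀, fun Q h0 _ => h0⟩ ?_
    · obtain ⟨_, _, hI, _⟩ := key
      haveI := hI
      exact isIrreducible_preimage_closedPoint O P' (σ ≫ q)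
    · intro X' X'' σ' Y' C τ hQ hτ hC hflat himg _
      obtain ⟨hN', hR', hI', hch⟩ := hQ
      haveI := hN'
      haveI : IsProper τ := hτ.isProper
      -- the point of `Y'` over the generic point of `Y` is a special-fibre point off the centre
      obtain ⟨ξ', hfib, hY'⟩ := Chain.fibre hch hξ
      have hξ'Y : ξ' ∈ Y' := by rw [hY']; exact subset_closure rfl
      have hσξ' : σ' ξ' = ξ := by
        have : ξ' ∈ σ' ⁻¹' {ξ} := by rw [hfib]; rfl
        simpa using this
      have hξ'C : ξ' ∉ (C.support : Set X') := fun h' => himg ⟨ξ', h', hσξ'⟩ hξ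
      have hξ's : (σ' ≫ q) ξ' = IsLocalRing.closedPoint O :=
        closure_subset_preimage_of_chain q hYirr hYcl hY hch (subset_closure hξ'Y)
      refine ⟨LocallyOfFiniteType.isLocallyNoetherian τ, hτ.isRegular_of_isRegular_subscheme hR' hC, ?_, ?_⟩
      · have h := isIntegral_specialFibre_of_isBlowup_regularCentre O X' X'' (σ' ≫ q) C hR' hC hflat τ hτ hI'
          ⟨ξ', hξ's, hξ'C⟩
        simpa only [Category.assoc] using h.1
      · exact fun Q h0 hstep => hstep X' X'' σ' Y' C τ (hch Q h0 hstep) hτ hC himg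

/-- **RESHAPE OF THE RESEARCH STUB (`stub_elnat_three` ⇐ its horizontal form).** If for every integral NON-REGULAR
hypersurface `H ⊆ ℙ³_k` (`k` algebraically closed of characteristic `p`) there are a characteristic-0 DVR `O` with a
surjection `π : O → k` and, for the fixed ambient `ℙ³_O` and `Y = ι ≫ Proj.map φ (H)`, a HORIZONTAL E1 chain (regular
`O`-FLAT centres over non-generic points of `Y`, special-fibre points of each centre in the current strict transform) whose
reduced last strict transform is regular, then `stub_elnat_three` (the route decl `EquisingularLiftNat` at `p`, `n = 3`)
holds: irreducibility of the last special fibre is AUTOMATIC (`natChain_and_isIrreducible_of_horizChainE1`), and a regular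
`H` needs no blow-up (`elnat_of_isRegular`). [folklore] -/
theorem stub_elnat_three_of_horiz (h : (∀ p : ℕ, p.Prime → ∀ (k : Type) [Field k] [CharP k p] [IsAlgClosed k] (n : ℕ) (H : AlgebraicGeometry.Scheme.{0}) (ι : H ⟶ (Literature.AlgebraicGeometry.Motives.projectiveSpace n k).left), AlgebraicGeometry.IsClosedImmersion ι → AlgebraicGeometry.IsIntegral H → (∀ y : (Literature.AlgebraicGeometry.Motives.projectiveSpace n k).left, ∃ U : (Literature.AlgebraicGeometry.Motives.projectiveSpace n k).left.affineOpens, y ∈ (U : (Literature.AlgebraicGeometry.Motives.projectiveSpace n k).left.Opens) ∧ (ι.ker.ideal U).IsPrincipal) → n = 3 → ¬ Literature.AlgebraicGeometry.Resolution.Scheme.IsRegular H → ∃ (O : Type) (_ : CommRing O) (_ : IsDomain O) (_ : IsDiscreteValuationRing O) (_ : CharZero O) (π : O →+* k), Function.Surjective π ∧ (letI := MvPolynomial.gradedAlgebra (σ := Fin (n + 1)) (R := O); letI := MvPolynomial.gradedAlgebra (σ := Fin (n + 1)) (R := k); ∀ (φ : MvPolynomial.homogeneousSubmodule (Fin (n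 + 1)) O →+*ᵍ MvPolynomial.homogeneousSubmodule (Fin (n + 1)) k) (hφ' : HomogeneousIdeal.irrelevant (MvPolynomial.homogeneousSubmodule (Fin (n + 1)) k) ≤ (HomogeneousIdeal.irrelevant (MvPolynomial.homogeneousSubmodule (Fin (n + 1)) O)).map φ), (∀ s, φ s = MvPolynomial.map π s) → ∀ Y : Set (AlgebraicGeometry.Proj (MvPolynomial.homogeneousSubmodule (Fin (n + 1)) O)), Y = Set.range (CategoryTheory.CategoryStruct.comp ι (AlgebraicGeometry.Proj.map φ hφ') : H ⟶ (AlgebraicGeometry.Proj (MvPolynomial.homogeneousSubmodule (Fin (n + 1)) O))) → ∃ (P' : AlgebraicGeometry.Scheme.{0}) (σ : P' ⟶ (AlgebraicGeometry.Proj (MvPolynomial.homogeneousSubmodule (Fin (n + 1)) O))) (S' : Set P'), (∀ Q : (∀ X' : AlgebraicGeometry.Scheme.{0}, (X' ⟶ (AlgebraicGeometry.Proj (MvPolynomial.homogeneousSubmodule (Fin (n + 1)) O))) → Set X' → Prop), Q (AlgebraicGeometry.Proj (MvPolynomial.homogeneousSubmodule (Fin (n + 1)) O)) (CategoryTheory.CategoryStruct.id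 _) Y → (∀ (X' X'' : AlgebraicGeometry.Scheme.{0}) (σ' : X' ⟶ (AlgebraicGeometry.Proj (MvPolynomial.homogeneousSubmodule (Fin (n + 1)) O))) (Y' : Set X') (C : X'.IdealSheafData) (τ : X'' ⟶ X'), Q X' σ' Y' → Literature.AlgebraicGeometry.Resolution.IsBlowup τ C → Literature.AlgebraicGeometry.Resolution.Scheme.IsRegular C.subscheme → AlgebraicGeometry.Flat (CategoryTheory.CategoryStruct.comp C.subschemeι (CategoryTheory.CategoryStruct.comp σ' (CategoryTheory.CategoryStruct.comp (AlgebraicGeometry.Proj.toSpecZero (MvPolynomial.homogeneousSubmodule (Fin (n + 1)) O)) (AlgebraicGeometry.Spec.map (CommRingCat.ofHom (algebraMap O (MvPolynomial.homogeneousSubmodule (Fin (n + 1)) O 0))))))) → σ' '' (C.support : Set X') ⊆ {x | ¬ IsGenericPoint x Y} → (C.support : Set X') ∩ (CategoryTheory.CategoryStruct.comp σ' (CategoryTheory.CategoryStruct.comp (AlgebraicGeometry.Proj.toSpecZero (MvPolynomial.homogeneousSubmodule (Fin (n + 1)) O)) (AlgebraicGeometry.Spec.map (CommRingCat.ofHom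 (algebraMap O (MvPolynomial.homogeneousSubmodule (Fin (n + 1)) O 0)))))) ⁻¹' {IsLocalRing.closedPoint O} ⊆ Y' → Q X'' (CategoryTheory.CategoryStruct.comp τ σ') (closure (τ ⁻¹' (Y' \ (C.support : Set X'))))) → Q P' σ S') ∧ Literature.AlgebraicGeometry.Resolution.Scheme.IsRegular (AlgebraicGeometry.Scheme.IdealSheafData.vanishingIdeal (⟨closure S', isClosed_closure⟩ : TopologicalSpace.Closeds P')).subscheme))) : (∀ p : ℕ, p.Prime → ∀ (k : Type) [Field k] [CharP k p] [IsAlgClosed k] (n : ℕ) (H : AlgebraicGeometry.Scheme.{0}) (ι : H ⟶ (Literature.AlgebraicGeometry.Motives.projectiveSpace n k).left), AlgebraicGeometry.IsClosedImmersion ι → AlgebraicGeometry.IsIntegral H → (∀ y : (Literature.AlgebraicGeometry.Motives.projectiveSpace n k).left, ∃ U : (Literature.AlgebraicGeometry.Motives.projectiveSpace n k).left.affineOpens, y ∈ (U : (Literature.AlgebraicGeometry.Motives.projectiveSpace n k).left.Opens) ∧ (ι.ker.ideal U).IsPrincipal) → n = 3 → ∃ (O : Type) (_ : CommRing O) (_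 : IsDomain O) (_ : IsDiscreteValuationRing O) (_ : CharZero O) (π : O →+* k), Function.Surjective π ∧ (letI := MvPolynomial.gradedAlgebra (σ := Fin (n + 1)) (R := O); letI := MvPolynomial.gradedAlgebra (σ := Fin (n + 1)) (R := k); ∀ (φ : MvPolynomial.homogeneousSubmodule (Fin (n + 1)) O →+*ᵍ MvPolynomial.homogeneousSubmodule (Fin (n + 1)) k) (hφ' : HomogeneousIdeal.irrelevant (MvPolynomial.homogeneousSubmodule (Fin (n + 1)) k) ≤ (HomogeneousIdeal.irrelevant (MvPolynomial.homogeneousSubmodule (Fin (n + 1)) O)).map φ), (∀ s, φ s = MvPolynomial.map π s) → ∀ Y : Set (AlgebraicGeometry.Proj (MvPolynomial.homogeneousSubmodule (Fin (n + 1)) O)), Y = Set.range (CategoryTheory.CategoryStruct.comp ι (AlgebraicGeometry.Proj.map φ hφ') : H ⟶ (AlgebraicGeometry.Proj (MvPolynomial.homogeneousSubmodule (Fin (n + 1)) O))) → ∃ (P' : AlgebraicGeometry.Scheme.{0}) (σ : P' ⟶ (AlgebraicGeometry.Proj (MvPolynomial.homogeneousSubmodule (Fin (n + 1)) O))) (S'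 : Set P'), (∀ Q : (∀ X' : AlgebraicGeometry.Scheme.{0}, (X' ⟶ (AlgebraicGeometry.Proj (MvPolynomial.homogeneousSubmodule (Fin (n + 1)) O))) → Set X' → Prop), Q (AlgebraicGeometry.Proj (MvPolynomial.homogeneousSubmodule (Fin (n + 1)) O)) (CategoryTheory.CategoryStruct.id _) Y → (∀ (X' X'' : AlgebraicGeometry.Scheme.{0}) (σ' : X' ⟶ (AlgebraicGeometry.Proj (MvPolynomial.homogeneousSubmodule (Fin (n + 1)) O))) (Y' : Set X') (C : X'.IdealSheafData) (τ : X'' ⟶ X'), Q X' σ' Y' → Literature.AlgebraicGeometry.Resolution.IsBlowup τ C → Literature.AlgebraicGeometry.Resolution.Scheme.IsRegular C.subscheme → σ' '' (C.support : Set X') ⊆ {x | ¬ IsGenericPoint x Y} → (C.support : Set X') ∩ (CategoryTheory.CategoryStruct.comp σ' (CategoryTheory.CategoryStruct.comp (AlgebraicGeometry.Proj.toSpecZero (MvPolynomial.homogeneousSubmodule (Fin (n + 1)) O)) (AlgebraicGeometry.Spec.map (CommRingCat.ofHom (algebraMap O (MvPolynomial.homogeneousSubmodule (Fin (n + 1))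 O 0)))))) ⁻¹' {IsLocalRing.closedPoint O} ⊆ Y' → Q X'' (CategoryTheory.CategoryStruct.comp τ σ') (closure (τ ⁻¹' (Y' \ (C.support : Set X'))))) → Q P' σ S') ∧ IsIrreducible ((CategoryTheory.CategoryStruct.comp σ (CategoryTheory.CategoryStruct.comp (AlgebraicGeometry.Proj.toSpecZero (MvPolynomial.homogeneousSubmodule (Fin (n + 1)) O)) (AlgebraicGeometry.Spec.map (CommRingCat.ofHom (algebraMap O (MvPolynomial.homogeneousSubmodule (Fin (n + 1)) O 0)))))) ⁻¹' {IsLocalRing.closedPoint O}) ∧ Literature.AlgebraicGeometry.Resolution.Scheme.IsRegular (AlgebraicGeometry.Scheme.IdealSheafData.vanishingIdeal (⟨closure S', isClosed_closure⟩ : TopologicalSpace.Closeds P')).subscheme)) := by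
  classical
  intro p hp k _ _ _ n H ι hι hH hloc h3
  by_cases hHreg : Scheme.IsRegular H
  · exact elnat_of_isRegular p hp k n H ι hι hH hloc hHreg
  obtain ⟨O, i1, i2, i3, i4, π, hπ, h'⟩ := h p hp k n H ι hι hH hloc h3 hHreg
  -- the gradings by degree (Mathlib abbrevs, not instances; the statement carries them as `letI`)
  letI := MvPolynomial.gradedAlgebra (σ := Fin (n + 1)) (R := O)
  letI := MvPolynomial.gradedAlgebra (σ := Fin (n + 1)) (R := k)
  refine ⟨O, i1, i2, i3, i4, π, hπ, ?_⟩
  intro φ hφ' hφ Y hY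
  obtain ⟨P', σ, S', hhz, hreg'⟩ := h' φ hφ' hφ Y hY
  subst hY
  -- the fixed ambient: special fibre, the embedding `g`, the closed irreducible `Y` inside the special fibre
  have hP := ProjectiveAmbientFibre.isPullback_projMap π φ hφ hπ hφ'
  set q : (AlgebraicGeometry.Proj (MvPolynomial.homogeneousSubmodule (Fin (n + 1)) O)) ⟶ Spec (.of O) :=
    Proj.toSpecZero (MvPolynomial.homogeneousSubmodule (Fin (n + 1)) O) ≫
      Spec.map (CommRingCat.ofHom (algebraMap O (MvPolynomial.homogeneousSubmodule (Fin (n + 1)) O 0))) with hq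
  set g : (AlgebraicGeometry.Proj (MvPolynomial.homogeneousSubmodule (Fin (n + 1)) k)) ⟶ (AlgebraicGeometry.Proj (MvPolynomial.homogeneousSubmodule (Fin (n + 1)) O)) :=
    Proj.map φ hφ' with hg
  haveI : IsClosedImmersion (Spec.map (CommRingCat.ofHom π)) := IsClosedImmersion.spec_of_surjective _ hπ
  haveI : IsClosedImmersion g := MorphismProperty.IsStableUnderBaseChange.of_isPullback hP.flip inferInstance
  have hpt : ∀ x : Spec (.of k), Spec.map (CommRingCat.ofHom π) x = IsLocalRing.closedPoint O := by
    intro x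
    rw [Spec.map_apply]
    apply PrimeSpectrum.ext
    rw [PrimeSpectrum.comap_asIdeal, CommRingCat.hom_ofHom, Ideal.eq_bot_of_prime x.asIdeal, ← RingHom.ker_eq_comap_bot]
    exact IsLocalRing.eq_maximalIdeal (RingHom.ker_isMaximal_of_surjective π hπ)
  have hgq : ∀ x, q (g x) = IsLocalRing.closedPoint O := fun x ↦
    (Scheme.Hom.comp_apply g q x).symm.trans
      ((congrArg (fun h : (AlgebraicGeometry.Proj (MvPolynomial.homogeneousSubmodule (Fin (n + 1)) k)) ⟶ Spec (.of O) ↦ h x) hP.w).trans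
        ((Scheme.Hom.comp_apply _ _ x).trans (hpt _)))
  haveI := hH
  let ι' : H ⟶ (AlgebraicGeometry.Proj (MvPolynomial.homogeneousSubmodule (Fin (n + 1)) k)) := ι
  haveI : IsClosedImmersion ι' := hι
  let f : H ⟶ (AlgebraicGeometry.Proj (MvPolynomial.homogeneousSubmodule (Fin (n + 1)) O)) := ι' ≫ g
  have hf : Set.range (CategoryStruct.comp ι g : H ⟶ (AlgebraicGeometry.Proj (MvPolynomial.homogeneousSubmodule (Fin (n + 1)) O))) = Set.range f := rfl
  have hYcl : IsClosed (Set.range f) := f.isClosedEmbedding.isClosed_range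
  have hsub : Set.range f ⊆ q ⁻¹' {IsLocalRing.closedPoint O} := by
    rintro _ ⟨x, rfl⟩
    show q (f x) = IsLocalRing.closedPoint O
    rw [show f x = g (ι' x) from Scheme.Hom.comp_apply _ _ x]
    exact hgq (ι' x)
  have hgen : IsGenericPoint (f (genericPoint H)) (Set.range f) := by
    have h := (genericPoint_spec H).image f.continuous
    rwa [Set.image_univ, f.isClosedEmbedding.isClosed_range.closure_eq] at h
  have hYirr : IsIrreducible (Set.range f) := by
    have h := (isIrreducible_singleton (x := f (genericPoint H))).closure
    rwa [hgen] at h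
  obtain ⟨hsm, hprop⟩ := stub_projectiveAmbientSmoothProper O n
  have hint := isIntegral_specialFibre_projectiveSpace O n
  rw [hf] at hhz ⊢
  obtain ⟨hch, hirr⟩ :=
    natChain_and_isIrreducible_of_horizChainE1 O _ P' q (Set.range f) σ S' hsm hprop hint hYirr hYcl hsub hhz
  exact ⟨P', σ, S', hch, hirr, hreg'⟩

end Summit.ResolutionOfSingularities.ResolutionOfSingularities.Cruxes.EquisingularLiftNat.Sections

end
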